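import Literature.Probability.LatticeModels.LayeredPlaneRotatorStackStiffnessTransition
import HarnessLib

/-!
# The decoupled stack on the periodic two-point objects: at `K⊥ = 0` the stack's torus two-point function
# is the layer's inside a layer and vanishes across layers; `χ^{3D,per}_L(K∥, 0) = χ^{2D,per}_L(K∥)` and
# `plateau_L(K∥, K∥, 0) ≤ 1/L` at every `L`

Topic `Literature/Probability/LatticeModels`. Companion of `LayeredPlaneRotatorStackStiffnessTransition.lean`
(p590350, §1: at zero coupling on the last direction the Gibbs state of `torusXY (d+1) L` is the product of `L`
independent layers `torusXY d L` — `torusXY_expectJ_stack_layer`, `torusXY_expectJ_stack_layer_mul_layer`) for the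
PERIODIC two-point objects of the floor files (`AnisotropicRotator.corr`, `plateau`; the torus susceptibility
`χ^{per}_L = ∑_y ⟨cos(θ_0 − θ_y)⟩` of `PlaneRotatorPeriodicSusceptibility.lean` /
`LayeredPlaneRotatorPeriodicSusceptibility.lean`). Everything is PROVED; no definition, no named fact, no numerics.

## Contents

* §1 **Global rotation invariance** of every plane-rotator Gibbs state on a finite bond system (`θ ↦ θ·c`, `c ∈ U(1)`
  constant: the bond characters and the weight are unchanged, the Haar measure is translation invariant), hence
  **the single-spin expectations vanish**: `⟨Re θ_v⟩_J = ⟨Im θ_v⟩_J = 0` (`BondSystem.expectJ_re_apply_eq_zero`,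
  `…_im_…`; rotation by `π`).
* §2 **Two-point functions of the decoupled stack** (every `d`, couplings `Fin.snoc K 0`): inside a layer
  `⟨cos(θ_{(y,k)} − θ_{(y',k)})⟩^{(d+1)} = ⟨cos(θ_y − θ_{y'})⟩^{(d)}_K` (`torusXY_expectJ_cosDiff_stack_same_layer`); across two
  layers `k ≠ k'` it VANISHES (`torusXY_expectJ_cosDiff_stack_cross_layer`: `cos(θ_x − θ_{x'}) = Re θ_x Re θ_{x'} + Im θ_x Im θ_{x'}`,
  independence of the layers and §1); so the torus susceptibility of the stack is the layer's,
  `∑_{x'} ⟨cos(θ_x − θ_{x'})⟩^{(d+1)} = ∑_{y'} ⟨cos(θ_y − θ_{y'})⟩^{(d)}` (`sum_torusXY_expectJ_cosDiff_stack`).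
* §3 **The layered rotator on `(ℤ/Lℤ)³` at `K⊥ = 0`** (`AnisotropicRotator.corr`, the periodic object of the floor files):
  `corr (K∥,K∥,0) (y,k) (y',k) = ⟨cos(θ_y − θ_{y'})⟩^{2D}_{K∥,L}`, `corr (K∥,K∥,0) (y,k) (y',k') = 0` for `k ≠ k'`,
  **`χ^{3D,per}_L(K∥, 0) = ∑_x corr (K∥,K∥,0) 0 x = ∑_y ⟨cos(θ_0 − θ_y)⟩^{2D}_{K∥,L} = χ^{2D,per}_L(K∥)`**
  (`torus_susceptibility_layered_zero`) — so the periodic susceptibility of the decoupled stack is bounded in `L` iff the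
  layer's is (`torus_susceptibility_bounded_layered_zero_iff`) — and the long-range-order parameter of the decoupled
  stack is `O(1/L)`: `0 ≤ plateau_L(K∥,K∥,0) = (∑_{y,y'} ⟨cos(θ_y − θ_{y'})⟩^{2D})/L⁵ ≤ 1/L` (`plateau_layered_zero_le`) —
  decoupled layers never order in three dimensions, whatever the state of one layer.

Cell `pub/hubbard-tc` (MO-S3; G2 2D→3D ordering lemma — the `J⊥ = 0` end on mod-1's periodic objects), classical
layered comparison model only, number-neutral. WHAT THIS IS NOT: nothing at `J⊥ > 0` (there the comparison is the
Griffiths–Ginibre inequality of `LayeredPlaneRotatorPeriodicSusceptibility.lean`, not an identity); never a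
Hubbard-model or material statement.

## References

* L. L. Liu, H. E. Stanley, Phys. Rev. Lett. 29 (1972) 927, p. 272 (layers `(J, J, εJ)`; `ε = 0` = independent
  layers). [LiuStanley1972]
* J. Ginibre, Comm. Math. Phys. 16 (1970) 310, Example 4 (plane rotators). [Ginibre1970]
* S. Friedli, Y. Velenik, *Statistical Mechanics of Lattice Systems*, CUP 2017, §3.1 and (10.39)–(10.42) (symmetries
  of the Gibbs state; the plateau / long-range-order parameter). [FriedliVelenik2017] [FriedliVelenikSMLS2017]

Tree: `BondSystem.bondChar(_apply)/bondVar_one/weightJ/expectJ(_eq)/expectJ_const_mul/expectJ_add'`,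
`integral_torusHaar_mul_right`, `cosDiff`, `torusXY_expectJ_stack_layer`, `torusXY_expectJ_stack_layer_mul_layer`,
`layeredCoupling_zero_eq_snoc`, `AnisotropicRotator.corr(_eq_expectJ/_nonneg/_le_one)`, `plateau`. Mathlib:
`Fin.snocEquiv`, `Finset.sum_eq_single`, `Complex.mul_re`.
-/

noncomputable section

open MeasureTheory Finset Filter
open scoped BigOperators

namespace Literature.Probability.LatticeModels

/-! ## §1 Global rotation invariance; single-spin expectations vanish -/

namespace BondSystem

variable {V ι : Type*} (G : BondSystem V ι)

/-- A global rotation `θ ↦ θ·c` (`c ∈ U(1)` the same at every site) leaves every bond character unchanged: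
`χ_a(θ·c) = (θ_{src a} c)⁻¹ (θ_{tgt a} c) = χ_a(θ)`. [cite: Ginibre1970, Example 4 (plane rotators: the interaction depends on angle differences)] -/
theorem bondChar_mul_const (a : ι) (θ : V → Circle) (c : Circle) :
    G.bondChar a (θ * fun _ => c) = G.bondChar a θ := by
  rw [bondChar_apply, bondChar_apply, bondVar_one, bondVar_one, Pi.mul_apply, Pi.mul_apply, mul_inv,
    mul_mul_mul_comm, inv_mul_cancel, mul_one]

variable [Fintype ι]

/-- The Gibbs weight is invariant under global rotations. [cite: Ginibre1970, Example 4 (plane rotators: the interaction depends on angle differences)] -/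
theorem weightJ_mul_const (J : ι → ℝ) (θ : V → Circle) (c : Circle) :
    G.weightJ J (θ * fun _ => c) = G.weightJ J θ := by
  simp only [weightJ, ginibreWeight, ginibreHamiltonian, reChar, bondChar_mul_const]

variable [Fintype V] [MeasurableSpace Circle] [BorelSpace Circle]

/-- **Global rotation invariance of the Gibbs state**: `⟨f(θ·c)⟩_J = ⟨f⟩_J` for every observable `f` and every
`c ∈ U(1)` (translation invariance of the Haar measure of `U(1)^V`, `integral_torusHaar_mul_right`, and of the
weight). [cite: FriedliVelenik2017, §3.1 (symmetries of the Gibbs state); Ginibre1970, Example 4 (plane rotators)] -/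
theorem expectJ_mul_const (J : ι → ℝ) (f : (V → Circle) → ℝ) (c : Circle) :
    G.expectJ J (fun θ => f (θ * fun _ => c)) = G.expectJ J f := by
  rw [G.expectJ_eq, G.expectJ_eq]
  congr 1
  calc ∫ θ, f (θ * fun _ => c) * G.weightJ J θ ∂torusHaar V
      = ∫ θ, (fun η : V → Circle => f η * G.weightJ J η) (θ * fun _ => c) ∂torusHaar V := by
        refine integral_congr_ae (ae_of_all _ fun θ => ?_)
        simp only [weightJ_mul_const]
    _ = ∫ η, f η * G.weightJ J η ∂torusHaar V :=
        integral_torusHaar_mul_right (fun η : V → Circle => f η * G.weightJ J η) (fun _ => c)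

/-- **The single-spin expectation vanishes: `⟨Re θ_v⟩_J = 0`** (rotation by `π`: `Re(−θ_v) = −Re θ_v`).
[cite: FriedliVelenik2017, §3.1 (symmetries of the Gibbs state: ⟨S_v⟩ = 0 in finite volume); Ginibre1970, Example 4] -/
theorem expectJ_re_apply_eq_zero (J : ι → ℝ) (v : V) :
    G.expectJ J (fun θ => ((θ v : Circle) : ℂ).re) = 0 := by
  have h := G.expectJ_mul_const J (fun θ => ((θ v : Circle) : ℂ).re) (-1)
  have hneg : (fun θ : V → Circle => (((θ * fun _ => (-1 : Circle) : V → Circle) v : Circle) : ℂ).re) =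
      fun θ => (-1 : ℝ) * ((θ v : Circle) : ℂ).re := by
    funext θ
    rw [Pi.mul_apply, mul_neg_one, Circle.coe_neg, Complex.neg_re, neg_one_mul]
  rw [hneg, G.expectJ_const_mul] at h
  linarith

/-- **`⟨Im θ_v⟩_J = 0`** likewise. [cite: FriedliVelenik2017, §3.1 (symmetries of the Gibbs state: ⟨S_v⟩ = 0 in finite volume); Ginibre1970, Example 4] -/
theorem expectJ_im_apply_eq_zero (J : ι → ℝ) (v : V) :
    G.expectJ J (fun θ => ((θ v : Circle) : ℂ).im) = 0 := by
  have h := G.expectJ_mul_const J (fun θ => ((θ v : Circle) : ℂ).im) (-1)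
  have hneg : (fun θ : V → Circle => (((θ * fun _ => (-1 : Circle) : V → Circle) v : Circle) : ℂ).im) =
      fun θ => (-1 : ℝ) * ((θ v : Circle) : ℂ).im := by
    funext θ
    rw [Pi.mul_apply, mul_neg_one, Circle.coe_neg, Complex.neg_im, neg_one_mul]
  rw [hneg, G.expectJ_const_mul] at h
  linarith

end BondSystem

/-! ## §2 Two-point functions of the decoupled stack -/

section Stack

variable {d L : ℕ}

/-- Inside a layer the two-point observable of the stack is the layer's two-point observable of the restricted
configuration: `cos(θ_{(y,k)} − θ_{(y',k)}) = cos((θ|_k)_y − (θ|_k)_{y'})`. [cite: LiuStanley1972, p. 272 (layers) — bookkeeping] -/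
theorem cosDiff_stack_same_layer (y y' : TorusSite d L) (k : ZMod L) :
    (cosDiff (Fin.snoc y k : TorusSite (d + 1) L) (Fin.snoc y' k) : (TorusSite (d + 1) L → Circle) → ℝ) =
      fun θ => cosDiff y y' (fun z => θ (Fin.snoc z k)) :=
  rfl

/-- `cos(θ_x − θ_{x'}) = Re θ_x · Re θ_{x'} + Im θ_x · Im θ_{x'}` as observables. [cite: Ginibre1970, Example 4 (plane rotators) — bookkeeping] -/
theorem cosDiff_eq_re_mul_re_add_im_mul_im {V : Type*} (x x' : V) (θ : V → Circle) :
    cosDiff x x' θ = ((θ x : Circle) : ℂ).re * ((θ x' : Circle) : ℂ).re + ((θ x : Circle) : ℂ).im * ((θ x' : Circle) : ℂ).im := by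
  rw [cosDiff, Complex.mul_re, Complex.conj_re, Complex.conj_im]
  ring

variable [NeZero L] [MeasurableSpace Circle] [BorelSpace Circle]

/-- **Inside a layer the stack's two-point function is the layer's**:
`⟨cos(θ_{(y,k)} − θ_{(y',k)})⟩^{(d+1)}_{snoc K 0} = ⟨cos(θ_y − θ_{y'})⟩^{(d)}_K` (one-layer observable, `torusXY_expectJ_stack_layer`).
[cite: LiuStanley1972, p. 272 (ε = 0: independent layers); Ginibre1970, Example 4 (plane rotators)] -/
theorem torusXY_expectJ_cosDiff_stack_same_layer (K : Fin d → ℝ) (y y' : TorusSite d L) (k : ZMod L) :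
    (torusXY (d + 1) L).expectJ (fun b => (Fin.snoc K 0 : Fin (d + 1) → ℝ) b.2)
        (cosDiff (Fin.snoc y k : TorusSite (d + 1) L) (Fin.snoc y' k)) =
      (torusXY d L).expectJ (fun b => K b.2) (cosDiff y y') := by
  rw [cosDiff_stack_same_layer, torusXY_expectJ_stack_layer]

/-- **Across two different layers the stack's two-point function vanishes**:
`⟨cos(θ_{(y,k)} − θ_{(y',k')})⟩^{(d+1)}_{snoc K 0} = 0` for `k ≠ k'` — `cos(θ_x − θ_{x'}) = Re θ_x Re θ_{x'} + Im θ_x Im θ_{x'}`,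
the two layers are independent (`torusXY_expectJ_stack_layer_mul_layer`) and each single-spin expectation vanishes
(`expectJ_re_apply_eq_zero`, `expectJ_im_apply_eq_zero`). [cite: LiuStanley1972, p. 272 (ε = 0: independent layers); FriedliVelenik2017, §3.1 (⟨S_v⟩ = 0)] -/
theorem torusXY_expectJ_cosDiff_stack_cross_layer (K : Fin d → ℝ) (y y' : TorusSite d L) {k k' : ZMod L}
    (hkk' : k ≠ k') :
    (torusXY (d + 1) L).expectJ (fun b => (Fin.snoc K 0 : Fin (d + 1) → ℝ) b.2)
        (cosDiff (Fin.snoc y k : TorusSite (d + 1) L) (Fin.snoc y' k')) = 0 := by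
  have hsplit : (cosDiff (Fin.snoc y k : TorusSite (d + 1) L) (Fin.snoc y' k') : (TorusSite (d + 1) L → Circle) → ℝ) =
      fun θ => (fun η : TorusSite d L → Circle => ((η y : Circle) : ℂ).re) (fun z => θ (Fin.snoc z k)) *
          (fun η : TorusSite d L → Circle => ((η y' : Circle) : ℂ).re) (fun z => θ (Fin.snoc z k')) +
        (fun η : TorusSite d L → Circle => ((η y : Circle) : ℂ).im) (fun z => θ (Fin.snoc z k)) *
          (fun η : TorusSite d L → Circle => ((η y' : Circle) : ℂ).im) (fun z => θ (Fin.snoc z k')) := by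
    funext θ
    exact cosDiff_eq_re_mul_re_add_im_mul_im _ _ θ
  have h1 := torusXY_expectJ_stack_layer_mul_layer (L := L) K hkk'
    (fun η : TorusSite d L → Circle => ((η y : Circle) : ℂ).re) (fun η : TorusSite d L → Circle => ((η y' : Circle) : ℂ).re)
  have h2 := torusXY_expectJ_stack_layer_mul_layer (L := L) K hkk'
    (fun η : TorusSite d L → Circle => ((η y : Circle) : ℂ).im) (fun η : TorusSite d L → Circle => ((η y' : Circle) : ℂ).im)
  rw [(torusXY d L).expectJ_re_apply_eq_zero, zero_mul] at h1
  rw [(torusXY d L).expectJ_im_apply_eq_zero, zero_mul] at h2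
  rw [hsplit, (torusXY (d + 1) L).expectJ_add' _ (by fun_prop) (by fun_prop), h1, h2, add_zero]

/-- **The torus susceptibility of the decoupled stack is the layer's**: for every site `(y, k)` of the stack,
`∑_{x'} ⟨cos(θ_{(y,k)} − θ_{x'})⟩^{(d+1)}_{snoc K 0} = ∑_{y'} ⟨cos(θ_y − θ_{y'})⟩^{(d)}_K` (only the own layer contributes).
[cite: LiuStanley1972, p. 272 (ε = 0: independent layers); Ginibre1970, Example 4 (plane rotators)] -/
theorem sum_torusXY_expectJ_cosDiff_stack (K : Fin d → ℝ) (y : TorusSite d L) (k : ZMod L) :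
    ∑ x' : TorusSite (d + 1) L, (torusXY (d + 1) L).expectJ (fun b => (Fin.snoc K 0 : Fin (d + 1) → ℝ) b.2)
        (cosDiff (Fin.snoc y k : TorusSite (d + 1) L) x') =
      ∑ y' : TorusSite d L, (torusXY d L).expectJ (fun b => K b.2) (cosDiff y y') := by
  classical
  rw [← Fintype.sum_equiv (Fin.snocEquiv fun _ : Fin (d + 1) => ZMod L)
    (fun p => (torusXY (d + 1) L).expectJ (fun b => (Fin.snoc K 0 : Fin (d + 1) → ℝ) b.2)
      (cosDiff (Fin.snoc y k : TorusSite (d + 1) L) (Fin.snoc p.2 p.1)))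
    (fun x' => (torusXY (d + 1) L).expectJ (fun b => (Fin.snoc K 0 : Fin (d + 1) → ℝ) b.2)
      (cosDiff (Fin.snoc y k : TorusSite (d + 1) L) x'))
    (fun p => rfl), Fintype.sum_prod_type, Finset.sum_eq_single k (fun k' _ hk' => ?_)
    (fun hk => absurd (Finset.mem_univ k) hk)]
  · exact Finset.sum_congr rfl fun y' _ => torusXY_expectJ_cosDiff_stack_same_layer K y y' k
  · exact Finset.sum_eq_zero fun y' _ => torusXY_expectJ_cosDiff_stack_cross_layer K y y' (Ne.symm hk')

end Stack

/-! ## §3 The layered rotator on `(ℤ/Lℤ)³` at `K⊥ = 0`: `corr`, the torus susceptibility, the plateau -/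

namespace AnisotropicRotator

/- The floor files fix the Borel structure of `Circle` as a global instance (`corr`, `plateau`); the instance-generic
theorems of §1–§2 are used at that instance below. -/

variable {L : ℕ} [NeZero L]

/-- **Inside a layer, at `K⊥ = 0`, the stack's periodic two-point function is the layer's**:
`corr (K∥,K∥,0) (y,k) (y',k) = ⟨cos(θ_y − θ_{y'})⟩^{2D}_{K∥,L}` (the torus two-point function of `torusXY 2 L` at
constant coupling `K∥`). [cite: LiuStanley1972, p. 272 (ε = 0: independent layers); Ginibre1970, Example 4 (plane rotators)] -/
theorem corr_layered_zero_same_layer (Kp : ℝ) (y y' : TorusSite 2 L) (k : ZMod L) :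
    corr (layeredCoupling Kp 0) (Fin.snoc y k) (Fin.snoc y' k) = (torusXY 2 L).expectJ (fun _ => Kp) (cosDiff y y') := by
  rw [corr_eq_expectJ, layeredCoupling_zero_eq_snoc]
  exact torusXY_expectJ_cosDiff_stack_same_layer (fun _ : Fin 2 => Kp) y y' k

/-- **Across layers, at `K⊥ = 0`, the stack's periodic two-point function vanishes**:
`corr (K∥,K∥,0) (y,k) (y',k') = 0` for `k ≠ k'`. [cite: LiuStanley1972, p. 272 (ε = 0: independent layers); FriedliVelenik2017, §3.1 (⟨S_v⟩ = 0)] -/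
theorem corr_layered_zero_cross_layer (Kp : ℝ) (y y' : TorusSite 2 L) {k k' : ZMod L} (hkk' : k ≠ k') :
    corr (layeredCoupling Kp 0) (Fin.snoc y k) (Fin.snoc y' k') = 0 := by
  rw [corr_eq_expectJ, layeredCoupling_zero_eq_snoc]
  exact torusXY_expectJ_cosDiff_stack_cross_layer (fun _ : Fin 2 => Kp) y y' hkk'

/-- The torus susceptibility of the decoupled stack seen from the site `(y, k)`:
`∑_x corr (K∥,K∥,0) (y,k) x = ∑_{y'} ⟨cos(θ_y − θ_{y'})⟩^{2D}_{K∥,L}`. [cite: LiuStanley1972, p. 272 (ε = 0: independent layers); Ginibre1970, Example 4] -/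
theorem sum_corr_layered_zero (Kp : ℝ) (y : TorusSite 2 L) (k : ZMod L) :
    ∑ x : TorusSite 3 L, corr (layeredCoupling Kp 0) (Fin.snoc y k) x =
      ∑ y' : TorusSite 2 L, (torusXY 2 L).expectJ (fun _ => Kp) (cosDiff y y') := by
  simp only [corr_eq_expectJ, layeredCoupling_zero_eq_snoc]
  exact sum_torusXY_expectJ_cosDiff_stack (fun _ : Fin 2 => Kp) y k

omit [NeZero L] in
/-- The origin of the stack is the origin of layer `0`: `(0 : (ℤ/L)³) = Fin.snoc (0 : (ℤ/L)²) 0`. [cite: LiuStanley1972, p. 272 (layers) — bookkeeping] -/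
theorem zero_eq_snoc_zero : (0 : TorusSite 3 L) = Fin.snoc (0 : TorusSite 2 L) 0 := by
  funext j
  refine Fin.lastCases ?_ (fun i => ?_) j
  · rw [Fin.snoc_last]; rfl
  · rw [Fin.snoc_castSucc]; rfl

/-- **`χ^{3D,per}_L(K∥, 0) = χ^{2D,per}_L(K∥)` at every `L`**: the periodic susceptibility of the decoupled stack,
`∑_x corr (K∥,K∥,0) 0 x`, is the single layer's `∑_y ⟨cos(θ_0 − θ_y)⟩^{2D}_{K∥,L}` (the object of
`PlaneRotatorPeriodicSusceptibility.lean`). [cite: LiuStanley1972, p. 272 (ε = 0: independent layers); Ginibre1970, Example 4 (plane rotators)] -/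
theorem torus_susceptibility_layered_zero (Kp : ℝ) :
    ∑ x : TorusSite 3 L, corr (layeredCoupling Kp 0) 0 x =
      ∑ y : TorusSite 2 L, (torusXY 2 L).expectJ (fun _ => Kp) (cosDiff 0 y) := by
  rw [zero_eq_snoc_zero, sum_corr_layered_zero]

omit [NeZero L] in
/-- **The decoupled stack's periodic susceptibility is bounded in `L` iff the layer's is** (same numbers at every `L`).
[cite: LiuStanley1972, p. 272 (ε = 0: independent layers); Simon1980CMP, Thm 1.3 (the phase χ < ∞)] -/
theorem torus_susceptibility_bounded_layered_zero_iff (Kp : ℝ) :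
    (∃ (B : ℝ) (L₀ : ℕ), ∀ (L : ℕ) [NeZero L], L₀ ≤ L → ∑ x : TorusSite 3 L, corr (layeredCoupling Kp 0) 0 x ≤ B) ↔
      ∃ (B : ℝ) (L₀ : ℕ), ∀ (L : ℕ) [NeZero L], L₀ ≤ L →
        ∑ y : TorusSite 2 L, (torusXY 2 L).expectJ (fun _ => Kp) (cosDiff 0 y) ≤ B := by
  simp only [torus_susceptibility_layered_zero]

/-- **The double sum**: `∑_{x,x'} corr (K∥,K∥,0) x x' = L · ∑_{y,y'} ⟨cos(θ_y − θ_{y'})⟩^{2D}_{K∥,L}` (each of the `L` layers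
contributes its own double sum; cross-layer terms vanish). [cite: LiuStanley1972, p. 272 (ε = 0: independent layers); FriedliVelenikSMLS2017, (10.39)–(10.42) (plateau)] -/
theorem sum_sum_corr_layered_zero (Kp : ℝ) :
    ∑ x : TorusSite 3 L, ∑ x' : TorusSite 3 L, corr (layeredCoupling Kp 0) x x' =
      L * ∑ y : TorusSite 2 L, ∑ y' : TorusSite 2 L, (torusXY 2 L).expectJ (fun _ => Kp) (cosDiff y y') := by
  rw [← Fintype.sum_equiv (Fin.snocEquiv fun _ : Fin 3 => ZMod L)
    (fun p => ∑ x' : TorusSite 3 L, corr (layeredCoupling Kp 0) (Fin.snoc p.2 p.1) x')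
    (fun x => ∑ x' : TorusSite 3 L, corr (layeredCoupling Kp 0) x x') (fun p => rfl), Fintype.sum_prod_type]
  simp only [sum_corr_layered_zero, Finset.sum_const, Finset.card_univ, ZMod.card, nsmul_eq_mul]

/-- **The plateau of the decoupled stack**: `plateau_L(K∥,K∥,0) = (∑_{y,y'} ⟨cos(θ_y − θ_{y'})⟩^{2D}_{K∥,L}) / L⁵`.
[cite: FriedliVelenikSMLS2017, (10.39)–(10.42) (the plateau ⟨‖m_L‖²⟩); LiuStanley1972, p. 272 (ε = 0)] -/
theorem plateau_layered_zero (Kp : ℝ) :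
    plateau L (layeredCoupling Kp 0) =
      (∑ y : TorusSite 2 L, ∑ y' : TorusSite 2 L, (torusXY 2 L).expectJ (fun _ => Kp) (cosDiff y y')) / (L : ℝ) ^ 5 := by
  have hL : (L : ℝ) ≠ 0 := Nat.cast_ne_zero.2 (NeZero.ne L)
  rw [plateau, sum_sum_corr_layered_zero, show ((L : ℝ) ^ 6) = (L : ℝ) ^ 5 * L by ring, mul_comm (L : ℝ),
    mul_div_mul_right _ _ hL]

/-- **Decoupled layers never order in three dimensions: `0 ≤ plateau_L(K∥,K∥,0) ≤ 1/L`** for `K∥ ≥ 0` (each of the `L⁴`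
layer terms is `≤ 1`, `corr_le_one`; the cross-layer terms vanish), so the long-range-order parameter of the stack at
`J⊥ = 0` tends to `0` whatever the state of one layer. [cite: FriedliVelenikSMLS2017, (10.39)–(10.42) (plateau / long-range order); LiuStanley1972, p. 272 (ε = 0: independent layers)] -/
theorem plateau_layered_zero_le {Kp : ℝ} (hp : 0 ≤ Kp) :
    0 ≤ plateau L (layeredCoupling Kp 0) ∧ plateau L (layeredCoupling Kp 0) ≤ 1 / L := by
  have hL : (0 : ℝ) < L := Nat.cast_pos.2 (Nat.pos_of_ne_zero (NeZero.ne L))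
  have hK : ∀ i, 0 ≤ layeredCoupling Kp 0 i := layeredCoupling_nonneg hp le_rfl
  refine ⟨div_nonneg (Finset.sum_nonneg fun x _ => Finset.sum_nonneg fun x' _ => corr_nonneg hK x x') (by positivity), ?_⟩
  -- each layer's double sum is at most `L⁴`
  have h2 : ∑ y : TorusSite 2 L, ∑ y' : TorusSite 2 L, (torusXY 2 L).expectJ (fun _ => Kp) (cosDiff y y') ≤ (L : ℝ) ^ 4 := by
    have hterm : ∀ y y' : TorusSite 2 L, (torusXY 2 L).expectJ (fun _ => Kp) (cosDiff y y') ≤ 1 := fun y y' => by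
      rw [← corr_layered_zero_same_layer Kp y y' 0]
      exact corr_le_one _ _ _
    calc ∑ y : TorusSite 2 L, ∑ y' : TorusSite 2 L, (torusXY 2 L).expectJ (fun _ => Kp) (cosDiff y y')
        ≤ ∑ _y : TorusSite 2 L, ∑ _y' : TorusSite 2 L, (1 : ℝ) :=
          Finset.sum_le_sum fun y _ => Finset.sum_le_sum fun y' _ => hterm y y'
      _ = (L : ℝ) ^ 4 := by
          simp only [Finset.sum_const, Finset.card_univ, nsmul_eq_mul, mul_one, Fintype.card_fun, ZMod.card,
            Fintype.card_fin]
          push_cast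
          ring
  rw [plateau_layered_zero, div_le_div_iff₀ (by positivity) hL, one_mul]
  calc (∑ y : TorusSite 2 L, ∑ y' : TorusSite 2 L, (torusXY 2 L).expectJ (fun _ => Kp) (cosDiff y y')) * L
      ≤ (L : ℝ) ^ 4 * L := mul_le_mul_of_nonneg_right h2 hL.le
    _ = (L : ℝ) ^ 5 := by ring

/-- Hence **`plateau_{L+1}(K∥,K∥,0) → 0`**: no long-range order in the decoupled stack (`K∥ ≥ 0`).
[cite: FriedliVelenikSMLS2017, (10.39)–(10.42) (plateau / long-range order); LiuStanley1972, p. 272 (ε = 0)] -/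
theorem tendsto_plateau_layered_zero {Kp : ℝ} (hp : 0 ≤ Kp) :
    Tendsto (fun L : ℕ => plateau (L + 1) (layeredCoupling Kp 0)) atTop (nhds 0) := by
  have h1 : Tendsto (fun L : ℕ => (1 : ℝ) / ((L + 1 : ℕ) : ℝ)) atTop (nhds 0) := by
    have h := tendsto_one_div_add_atTop_nhds_zero_nat (𝕜 := ℝ)
    refine h.congr fun L => ?_
    push_cast
    ring
  exact squeeze_zero (fun L => (plateau_layered_zero_le (L := L + 1) hp).1)
    (fun L => (plateau_layered_zero_le (L := L + 1) hp).2) h1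

end AnisotropicRotator

end Literature.Probability.LatticeModels
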